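/-
Copyright: statement-level skeleton of a published paper (lit-balaban cell, reader/typer r15; Phase-2 seat p19 taken by the
nominating reader). No proof claims beyond what the kernel checks below.
-/
import Literature.MathematicalPhysics.QuantumFieldTheory.Balaban1983to89.B3Sect2Statements

/-!
# B3 — T. Bałaban, *(Higgs)₂,₃ quantum fields in a finite volume. III. Renormalization*, CMP **88** (1983) 411–445:
the estimate (2.17), PROVED from the degree bookkeeping (2.1)–(2.3) by leg counting

statement-level skeleton of published theorems with citation tags; proofs where landed; nothing here is a claim about
the Yang–Mills mass gap

Source: held text `paper:balaban1983-higgs-2-3-quantum-fields-finite-volume`; render of p. 429 [PDF 19] read as an image.  Row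
B3.Eq2.17 of `HOME/lit-balaban-r15/ROWS-B3.md`; Phase-2 envelope seat p19 (PHASE2-TARGETS.md §G.3: "`Ineq217` from (2.1)–(2.3)
by leg counting").

p. 429, verbatim: *"For the graphs G which do not contain vertices of the form (1.13)–(1.15) we can easily prove the following
estimate D(G) ≥ −2(d−2)/2 − 1 + ((a number of vertices) − 1)(4−d)/2 + ((a number of external legs) − 1)(d−2)/2, (2.17)"* —
no printed proof ("we can easily prove").

THE PROOF TYPED HERE (vertex-local form of the graph, as in `B3Sect2Statements.graphDegree`: a finite family of vertices with
their counts (2.1) and incidences — how many of their legs / differentiations lie on internal lines — and the counterterm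
degrees of (2.3)).  A leg of a vertex that is not on an internal line is an external leg, so the number of external legs is
E = Σ_v (legs(v) − internal legs(v)) (`extLegs`).  For a vertex NOT of the form (1.14)–(1.15) and d ≥ 2,
D_G(v) ≥ D(v) + (legs(v) − internal legs(v))·(d−2)/2 (`degreeIn_ge_degree_add_ext`: each external leg raises the count by
(d−2)/2 ≥ 0, each differentiation off the internal lines by 1), hence with nonnegative counterterm degrees
D(G) = Σ_v D_G(v) − d + Σ(counterterm degrees) ≥ Σ_v D(v) + E(d−2)/2 − d (`graphDegree_ge_sum`), and with the printed
*"for all vertices D(v) ≥ (4−d)/2"* (p. 423; `B3VertexBridge.degree_toCounts_ge` for the catalogue) this is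
V(4−d)/2 + E(d−2)/2 − d, which IS the right side of (2.17): −2(d−2)/2 − 1 + (V−1)(4−d)/2 + (E−1)(d−2)/2 = V(4−d)/2 + E(d−2)/2 − d
(`rhs217_eq`).  Result: `ineq217_graphDegree`; and `B3Sect2Statements.Ineq217` for every `GraphFamily` whose graphs without
(1.13)–(1.15)-vertices are realized by such vertex data (`ineq217_of_realization`).  The reading "counterterm degrees ≥ 0" is
the case (2.2) (no δm²_k counterterms, or the counterterms δm²_fin, δm²_{K,k} of degree 0); for δm²_k counterterms print reduces
to the attached graph G′ (p. 423 "the degree of G is the same as the degree of a graph G′ obtained from G by attaching the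
corresponding graphs"), which has more vertices and the same external legs, so (2.17) for G′ implies (2.17) for G when d ≤ 4
(`rhs217_mono_vertices`).
-/

namespace Literature.MathematicalPhysics.QuantumFieldTheory.Balaban1983to89.B3Ineq217Proof

open B3Sect2Statements Finset

/-- The number of external legs of a vertex-local graph: the legs of its vertices that do not lie on internal lines.
[cite: Balaban1983Higgs3, (2.17) p.429] -/
def extLegs {ι : Type} (V : Finset ι) (vx : ι → GraphVertex) : ℕ :=
  ∑ v ∈ V, ((vx v).counts.scalarLegs + (vx v).counts.vectorLegs - ((vx v).inc.intScalar + (vx v).inc.intVector))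

/-- kernel: for a vertex not of the form (1.14)–(1.15), in d ≥ 2: D_G(v) ≥ D(v) + (number of its external legs)·(d−2)/2.
[cite: Balaban1983Higgs3, (2.1) p.422] -/
theorem degreeIn_ge_degree_add_ext (d : ℕ) (hd : 2 ≤ d) (c : VertexCounts) (hc : c.averaging = false) (i : Incidence c) :
    degree d c + (((c.scalarLegs + c.vectorLegs - (i.intScalar + i.intVector) : ℕ) : ℚ)) * (((d : ℚ) - 2) / 2)
      ≤ degreeIn d c i := by
  have hd' : (2 : ℚ) ≤ d := by exact_mod_cast hd
  have hle : i.intScalar + i.intVector ≤ c.scalarLegs + c.vectorLegs := Nat.add_le_add i.hScalar i.hVector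
  have hcast : (((c.scalarLegs + c.vectorLegs - (i.intScalar + i.intVector) : ℕ) : ℚ))
      = ((c.scalarLegs + c.vectorLegs : ℕ) : ℚ) - ((i.intScalar + i.intVector : ℕ) : ℚ) := by
    rw [Nat.cast_sub hle]
  have h2 : (i.intDiffs : ℚ) ≤ (c.diffs : ℚ) := by exact_mod_cast i.hDiffs
  simp only [degree, degreeIn, Incidence.full, hc, Bool.false_eq_true, if_false, add_zero]
  rw [hcast]
  push_cast
  nlinarith

/-- kernel: D(G) ≥ Σ_v D(v) + E·(d−2)/2 − d for a vertex-local graph without vertices of the form (1.14)–(1.15), with nonnegative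
counterterm degrees, d ≥ 2. [cite: Balaban1983Higgs3, (2.17) p.429] -/
theorem graphDegree_ge_sum (d : ℕ) (hd : 2 ≤ d) {ι : Type} (V : Finset ι) (vx : ι → GraphVertex)
    (hav : ∀ v ∈ V, (vx v).counts.averaging = false) (hct : ∀ v ∈ V, 0 ≤ (vx v).ctDeg) :
    (∑ v ∈ V, degree d (vx v).counts) + (extLegs V vx : ℚ) * (((d : ℚ) - 2) / 2) - d ≤ graphDegree d V vx := by
  unfold graphDegree extLegs
  have h1 : ∑ v ∈ V, (degree d (vx v).counts +
      ((((vx v).counts.scalarLegs + (vx v).counts.vectorLegs - ((vx v).inc.intScalar + (vx v).inc.intVector) : ℕ) : ℚ))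
        * (((d : ℚ) - 2) / 2)) ≤ ∑ v ∈ V, degreeIn d (vx v).counts (vx v).inc :=
    Finset.sum_le_sum fun v hv => degreeIn_ge_degree_add_ext d hd _ (hav v hv) _
  have h2 : (0 : ℚ) ≤ ∑ v ∈ V, (vx v).ctDeg := Finset.sum_nonneg fun v hv => hct v hv
  rw [Finset.sum_add_distrib, ← Finset.sum_mul] at h1
  push_cast
  linarith

/-- kernel: the right side of (2.17) rewritten: −2(d−2)/2 − 1 + (V−1)(4−d)/2 + (E−1)(d−2)/2 = V(4−d)/2 + E(d−2)/2 − d.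
[cite: Balaban1983Higgs3, (2.17) p.429] -/
theorem rhs217_eq (d V E : ℚ) :
    -2 * ((d - 2) / 2) - 1 + (V - 1) * ((4 - d) / 2) + (E - 1) * ((d - 2) / 2) = V * ((4 - d) / 2) + E * ((d - 2) / 2) - d := by
  ring

/-- kernel: the right side of (2.17) is monotone in the number of vertices for d ≤ 4 (used for the reduction G ↦ G′ of p. 423).
[cite: Balaban1983Higgs3, (2.17) p.429] -/
theorem rhs217_mono_vertices (d V V' E : ℚ) (hd : d ≤ 4) (hV : V ≤ V') :
    -2 * ((d - 2) / 2) - 1 + (V - 1) * ((4 - d) / 2) + (E - 1) * ((d - 2) / 2)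
      ≤ -2 * ((d - 2) / 2) - 1 + (V' - 1) * ((4 - d) / 2) + (E - 1) * ((d - 2) / 2) := by
  nlinarith

/-- **(2.17)** p. 429 [PDF 19], PROVED for vertex-local graphs: if no vertex is of the form (1.14)–(1.15), every vertex has
D(v) ≥ (4−d)/2 (p. 423), the counterterm degrees are ≥ 0, and 2 ≤ d, then
D(G) ≥ −2(d−2)/2 − 1 + (V − 1)(4−d)/2 + (E − 1)(d−2)/2 with V = number of vertices, E = number of external legs.
[cite: Balaban1983Higgs3, (2.17) p.429] -/
theorem ineq217_graphDegree (d : ℕ) (hd : 2 ≤ d) {ι : Type} (V : Finset ι) (vx : ι → GraphVertex)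
    (hav : ∀ v ∈ V, (vx v).counts.averaging = false) (hct : ∀ v ∈ V, 0 ≤ (vx v).ctDeg)
    (hdeg : ∀ v ∈ V, (4 - (d : ℚ)) / 2 ≤ degree d (vx v).counts) :
    -2 * (((d : ℚ) - 2) / 2) - 1 + ((V.card : ℚ) - 1) * ((4 - (d : ℚ)) / 2) + ((extLegs V vx : ℚ) - 1) * (((d : ℚ) - 2) / 2)
      ≤ graphDegree d V vx := by
  have h1 := graphDegree_ge_sum d hd V vx hav hct
  have h2 : (V.card : ℚ) * ((4 - (d : ℚ)) / 2) ≤ ∑ v ∈ V, degree d (vx v).counts := by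
    have := Finset.card_nsmul_le_sum V (fun v => degree d (vx v).counts) ((4 - (d : ℚ)) / 2) fun v hv => hdeg v hv
    simpa [nsmul_eq_mul] using this
  rw [rhs217_eq]
  linarith

/-- **(2.17)** for an abstract `GraphFamily` (the carrier of `B3Sect2Statements.Ineq217`) each of whose graphs WITHOUT vertices of
the form (1.13)–(1.15) is realized by vertex-local data as above (same number of vertices, of external legs, same degree):
`Ineq217 d F` holds.  PROVED. [cite: Balaban1983Higgs3, (2.17) p.429] -/
theorem ineq217_of_realization (d : ℕ) (hd : 2 ≤ d) (F : GraphFamily)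
    (real : ∀ G : F.Graph, ¬ F.hasVertex1315 G →
      ∃ (ι : Type) (V : Finset ι) (vx : ι → GraphVertex),
        (∀ v ∈ V, (vx v).counts.averaging = false) ∧ (∀ v ∈ V, 0 ≤ (vx v).ctDeg) ∧
        (∀ v ∈ V, (4 - (d : ℚ)) / 2 ≤ degree d (vx v).counts) ∧
        F.numVertices G = V.card ∧ F.numExtLegs G = extLegs V vx ∧ F.degree G = graphDegree d V vx) :
    Ineq217 d F := by
  intro G hG
  obtain ⟨ι, V, vx, hav, hct, hdeg, hV, hE, hD⟩ := real G hG
  rw [hV, hE, hD]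
  exact ineq217_graphDegree d hd V vx hav hct hdeg

end Literature.MathematicalPhysics.QuantumFieldTheory.Balaban1983to89.B3Ineq217Proof
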